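import Summits.CriticalPhenomena.PercolationContinuityZ3.Theorems.PercNearOneGluingNoHeavyLowerTailCubicThreePointFibreHqtCriterion
import Summits.CriticalPhenomena.PercolationContinuityZ3.Theorems.PercNearOneGluingNoHeavyLowerTailCubicThreePointFibreEnum
import Mathlib.Combinatorics.SimpleGraph.Connectivity.Finite
import HarnessLib

/-!
# `NoHeavyLowerTail` (stmt-CriticalPhenomena-4575) — fibre criterion for `H_{q+t}`, II–IV: tables, bitmask loop, failure counts

Support file (prover prim-sahi-p2; `--supports stmt-CriticalPhenomena-4575`), the `H_{q+t}` twin of `…FibreTable` / `…FibreEnum` reusing all their polynomial-free parts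
(`mk3`, `cellOK`, `toMask`, `FibM`, `fibFailTP`, …): `PolZH` (integer values of `Pol6H`), `FibFastH`, `FibH_eq_fast`, `FibFastH_eq_FibM`, and MAIN `hqtW_nonneg_of_fibM` —
injective numbering + correct tables + `0 ≤ FibM idx PolZH-table st sub` on all nested profiles ⇒ `H_{q+t}(law) ≥ 0` for ALL weights.  Used by `…FibreThetaHqt`.
[cite: Gladkov2024StrongFKG, Cor. 4.2]
-/

namespace Summit.CriticalPhenomena.PercolationContinuityZ3.Theorems

namespace TerminalGluing

open Finset SimpleGraph Literature.Probability.Percolation Literature.Probability.Percolation.DecisionTree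
open CubicThreePointStep CubicThreePointTerminal

variable {V : Type*} [DecidableEq V]

/-! ### Fast (integer, table-driven) evaluation of the fibre sums -/

section Fast

/-- The integer value of `Pol6H` at three unit cell vectors (cell labels `0=Q,1=U₁,2=U₂,3=U₃,4=T`). [folklore] -/
def PolZH (s₁ s₂ s₃ : Fin 5) : ℤ :=
  Pol6H (uZ s₁ 0) (uZ s₁ 1) (uZ s₁ 2) (uZ s₁ 3) (uZ s₁ 4) (uZ s₂ 0) (uZ s₂ 1) (uZ s₂ 2) (uZ s₂ 3) (uZ s₂ 4)
    (uZ s₃ 0) (uZ s₃ 1) (uZ s₃ 2) (uZ s₃ 3) (uZ s₃ 4)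

/-- Casting `PolZH` to `ℝ`. [folklore] -/
theorem PolZH_cast (s₁ s₂ s₃ : Fin 5) :
    ((PolZH s₁ s₂ s₃ : ℤ) : ℝ) = Pol6H (uR s₁ 0) (uR s₁ 1) (uR s₁ 2) (uR s₁ 3) (uR s₁ 4) (uR s₂ 0) (uR s₂ 1) (uR s₂ 2)
      (uR s₂ 3) (uR s₂ 4) (uR s₃ 0) (uR s₃ 1) (uR s₃ 2) (uR s₃ 3) (uR s₃ 4) := by
  have hc : ∀ s k : Fin 5, ((uZ s k : ℤ) : ℝ) = uR s k := by
    intro s k; unfold uZ uR; split_ifs <;> simp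
  simp only [PolZH, Pol6H, Hqt, Int.cast_add, Int.cast_sub, Int.cast_mul, hc]

variable (D : Finset (Sym2 V)) (K : Finset (Sym2 V)) (a b c : V)

variable (st : Finset (Sym2 V) → Fin 5)

/-- The fast integer fibre sum: enumerate the first two copies inside `A.1`, determine the third, read cells from the table `st`. [folklore] -/
def FibFastH (A : Finset (Sym2 V) × Finset (Sym2 V) × Finset (Sym2 V)) : ℤ :=
  ∑ S₁ ∈ A.1.powerset, ∑ S₂ ∈ A.1.powerset,
    if A.2.2 ⊆ S₁ ∧ A.2.2 ⊆ S₂ ∧ data3 S₁ S₂ (mk3 A S₁ S₂) = A then PolZH (st S₁) (st S₂) (st (mk3 A S₁ S₂)) else 0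

/-- With a correct table, `polIndH` of a triple inside `D` is the cast of `PolZH` of the labels. [folklore] -/
theorem polIndH_eq_cast [Fintype V] (hst : ∀ S ∈ D.powerset, cellOK K a b c S (st S) = true) {S₁ S₂ S₃ : Finset (Sym2 V)}
    (h₁ : S₁ ⊆ D) (h₂ : S₂ ⊆ D) (h₃ : S₃ ⊆ D) :
    polIndH K a b c S₁ S₂ S₃ = ((PolZH (st S₁) (st S₂) (st S₃) : ℤ) : ℝ) := by
  obtain ⟨e₁, e₂, e₃, e₄, e₅⟩ := ind_of_cellOK K a b c (hst S₁ (Finset.mem_powerset.mpr h₁))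
  obtain ⟨f₁, f₂, f₃, f₄, f₅⟩ := ind_of_cellOK K a b c (hst S₂ (Finset.mem_powerset.mpr h₂))
  obtain ⟨g₁, g₂, g₃, g₄, g₅⟩ := ind_of_cellOK K a b c (hst S₃ (Finset.mem_powerset.mpr h₃))
  rw [PolZH_cast, polIndH, e₁, e₂, e₃, e₄, e₅, f₁, f₂, f₃, f₄, f₅, g₁, g₂, g₃, g₄, g₅]

/-- **The fibre sum equals the fast integer fibre sum** (for profiles inside `D`, given a correct cell table). [folklore] -/
theorem FibH_eq_fast [Fintype V] (hst : ∀ S ∈ D.powerset, cellOK K a b c S (st S) = true)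
    {A : Finset (Sym2 V) × Finset (Sym2 V) × Finset (Sym2 V)} (hA : A.1 ⊆ D) :
    FibH D K a b c A = ((FibFastH st A : ℤ) : ℝ) := by
  unfold FibH FibFastH
  -- Step 1: the innermost sum has at most one nonzero term, at `mk3 A S₁ S₂`.
  have inner : ∀ S₁ ∈ D.powerset, ∀ S₂ ∈ D.powerset,
      (∑ S₃ ∈ D.powerset, if data3 S₁ S₂ S₃ = A then polIndH K a b c S₁ S₂ S₃ else 0) =
      if A.2.2 ⊆ S₁ ∧ A.2.2 ⊆ S₂ ∧ data3 S₁ S₂ (mk3 A S₁ S₂) = A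
        then (((PolZH (st S₁) (st S₂) (st (mk3 A S₁ S₂)) : ℤ) : ℝ)) else 0 := by
    intro S₁ hS₁ S₂ hS₂
    rw [Finset.mem_powerset] at hS₁ hS₂
    by_cases hd : data3 S₁ S₂ (mk3 A S₁ S₂) = A
    · obtain ⟨b₁, b₂, -, -, b₃⟩ := bounds_of_data3 hd
      rw [if_pos ⟨b₁, b₂, hd⟩]
      rw [Finset.sum_eq_single_of_mem (mk3 A S₁ S₂) (Finset.mem_powerset.mpr (b₃.trans hA))]
      · rw [if_pos hd, polIndH_eq_cast D K a b c st hst hS₁ hS₂ (b₃.trans hA)]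
      · intro S₃ _ hne
        rw [if_neg]
        intro hd'
        exact hne (eq_mk3_of_data3 hd')
    · rw [if_neg (fun h => hd h.2.2)]
      refine Finset.sum_eq_zero fun S₃ _ => ?_
      rw [if_neg]
      intro hd'
      exact hd (eq_mk3_of_data3 hd' ▸ hd')
  rw [Finset.sum_congr rfl (fun S₁ hS₁ => Finset.sum_congr rfl (fun S₂ hS₂ => inner S₁ hS₁ S₂ hS₂))]
  -- Step 2: restrict both outer sums to `A.1.powerset`.
  have hsub : A.1.powerset ⊆ D.powerset := Finset.powerset_mono.mpr hA
  push_cast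
  symm
  apply Finset.sum_subset_zero_on_sdiff hsub
  · intro S₁ hS₁
    rw [Finset.mem_sdiff] at hS₁
    refine Finset.sum_eq_zero fun S₂ _ => ?_
    rw [if_neg]
    intro h
    exact hS₁.2 (Finset.mem_powerset.mpr (bounds_of_data3 h.2.2).2.2.1)
  · intro S₁ _
    apply Finset.sum_subset_zero_on_sdiff hsub
    · intro S₂ hS₂
      rw [Finset.mem_sdiff] at hS₂
      rw [if_neg]
      intro h
      exact hS₂.2 (Finset.mem_powerset.mpr (bounds_of_data3 h.2.2).2.2.2.1)
    · intro S₂ _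
      rfl

/-- **Fibre criterion, computable form.**  Given a cell table correct on `D.powerset` and nonnegativity of all fast fibre sums over NESTED profiles
`A₃ ⊆ A₂ ⊆ A₁ ⊆ D` (a finite check), SHK3⁺ holds for all weights in `[0,1]`. [folklore] -/
theorem hqtW_nonneg_of_fibFastH [Fintype V] (p : Sym2 V → ℝ) (hp0 : ∀ e, 0 ≤ p e) (hp1 : ∀ e, p e ≤ 1)
    (hst : ∀ S ∈ D.powerset, cellOK K a b c S (st S) = true)
    (hcheck : ∀ A₁ ∈ D.powerset, ∀ A₂ ∈ A₁.powerset, ∀ A₃ ∈ A₂.powerset, 0 ≤ FibFastH st (A₁, A₂, A₃)) :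
    0 ≤ hqtW D p K a b c := by
  refine hqtW_nonneg_of_fibH D p K a b c hp0 hp1 fun A hA => ?_
  obtain ⟨A₁, A₂, A₃⟩ := A
  simp only [Finset.mem_product] at hA
  by_cases hn : A₃ ⊆ A₂ ∧ A₂ ⊆ A₁
  · have hA1 : A₁ ⊆ D := Finset.mem_powerset.mp hA.1
    rw [FibH_eq_fast D K a b c st hst (A := (A₁, A₂, A₃)) hA1]
    exact_mod_cast hcheck A₁ hA.1 A₂ (Finset.mem_powerset.mpr hn.2) A₃ (Finset.mem_powerset.mpr hn.1)
  · -- a non-nested profile has an empty fibre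
    unfold FibH
    refine le_of_eq (Eq.symm (Finset.sum_eq_zero fun S₁ _ => Finset.sum_eq_zero fun S₂ _ => Finset.sum_eq_zero fun S₃ _ => ?_))
    rw [if_neg]
    intro h
    have := data3_nested S₁ S₂ S₃
    rw [h] at this
    exact hn this

end Fast

section EnumH

variable (idx : Sym2 V → ℕ) {D : Finset (Sym2 V)} (pol : Fin 5 → Fin 5 → Fin 5 → ℤ) (st : ℕ → Fin 5) (sub : ℕ → Multiset ℕ)

/-- **`FibFast = FibM`**: the table-driven Finset double sum equals the bitmask double loop over consistent pairs (nested profile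
inside `D`, `idx` injective on `D`, `pol` a table of `PolZH`). [folklore] -/
theorem FibFastH_eq_FibM (hinj : Set.InjOn idx ↑D) (hpol : ∀ s₁ s₂ s₃, pol s₁ s₂ s₃ = PolZH s₁ s₂ s₃)
    (hsub : ∀ f, sub f = submasks f)
    {A : Finset (Sym2 V) × Finset (Sym2 V) × Finset (Sym2 V)} (hA : A.1 ⊆ D) (hn : A.2.2 ⊆ A.2.1 ∧ A.2.1 ⊆ A.1) :
    FibFastH (fun S => st (toMask idx S)) A = FibM idx pol st sub A := by
  have h21 : A.2.1 ⊆ D := hn.2.trans hA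
  have h22 : A.2.2 ⊆ D := hn.1.trans h21
  have h31 : A.2.2 ⊆ A.1 := hn.1.trans hn.2
  have hfree : ∀ X, freeY A X ⊆ A.1 := fun X => Finset.union_subset (Finset.sdiff_subset.trans Finset.sdiff_subset)
    (Finset.inter_subset_left.trans (Finset.sdiff_subset.trans hn.2))
  -- the term, in Finset form and in mask form
  have hterm : ∀ S₁, S₁ ⊆ A.1 → ∀ S₂, S₂ ⊆ A.1 →
      (if data3 S₁ S₂ (mk3 A S₁ S₂) = A then PolZH (st (toMask idx S₁)) (st (toMask idx S₂)) (st (toMask idx (mk3 A S₁ S₂))) else 0)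
        = termM pol st (toMask idx A.1) (toMask idx A.2.1) (toMask idx A.2.2) (toMask idx S₁) (toMask idx S₂) := by
    intro S₁ hS₁ S₂ hS₂
    have hm3 : mk3 A S₁ S₂ ⊆ D := by
      unfold mk3
      exact Finset.union_subset (Finset.union_subset h22 (Finset.sdiff_subset.trans (Finset.sdiff_subset.trans h21)))
        (Finset.sdiff_subset.trans (Finset.sdiff_subset.trans hA))
    unfold termM
    rw [← toMask_mk3 idx hinj hA hn (hS₁.trans hA) (hS₂.trans hA), hpol]
    by_cases h3 : data3 S₁ S₂ (mk3 A S₁ S₂) = A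
    · rw [if_pos h3, if_pos ((data3_eq_iff_mask idx hinj hA hn (hS₁.trans hA) (hS₂.trans hA) hm3).mp h3)]
    · rw [if_neg h3, if_neg (fun h => h3 ((data3_eq_iff_mask idx hinj hA hn (hS₁.trans hA) (hS₂.trans hA) hm3).mpr h))]
  -- Step 1: FibFast reindexed over (X, Y)
  have step1 : FibFastH (fun S => st (toMask idx S)) A =
      ∑ X ∈ (A.1 \ A.2.2).powerset, ∑ Y ∈ (freeY A X).powerset,
        termM pol st (toMask idx A.1) (toMask idx A.2.1) (toMask idx A.2.2) (toMask idx X ||| toMask idx A.2.2)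
          ((toMask idx A.2.2 ||| toMask idx ((A.2.1 \ A.2.2) \ X)) ||| toMask idx Y) := by
    unfold FibFastH
    have hre : ∀ S₁ ∈ A.1.powerset, (∑ S₂ ∈ A.1.powerset,
        (if A.2.2 ⊆ S₁ ∧ A.2.2 ⊆ S₂ ∧ data3 S₁ S₂ (mk3 A S₁ S₂) = A
          then PolZH (st (toMask idx S₁)) (st (toMask idx S₂)) (st (toMask idx (mk3 A S₁ S₂))) else 0)) =
        if A.2.2 ⊆ S₁ then ∑ S₂ ∈ A.1.powerset, (if A.2.2 ⊆ S₂ ∧ data3 S₁ S₂ (mk3 A S₁ S₂) = A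
          then PolZH (st (toMask idx S₁)) (st (toMask idx S₂)) (st (toMask idx (mk3 A S₁ S₂))) else 0) else 0 := by
      intro S₁ _
      by_cases h1 : A.2.2 ⊆ S₁
      · rw [if_pos h1]
        refine Finset.sum_congr rfl fun S₂ _ => ?_
        by_cases h2 : A.2.2 ⊆ S₂ ∧ data3 S₁ S₂ (mk3 A S₁ S₂) = A
        · rw [if_pos ⟨h1, h2⟩, if_pos h2]
        · rw [if_neg (fun h => h2 h.2), if_neg h2]
      · rw [if_neg h1]
        refine Finset.sum_eq_zero fun S₂ _ => ?_
        rw [if_neg (fun h => h1 h.1)]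
    rw [Finset.sum_congr rfl hre, sum_superset_reindex h31]
    refine Finset.sum_congr rfl fun X hX => ?_
    rw [Finset.mem_powerset] at hX
    have hXA : X ⊆ A.1 := hX.trans Finset.sdiff_subset
    have hS₁ : X ∪ A.2.2 ⊆ A.1 := Finset.union_subset hXA h31
    rw [sum_S₂_reindex hn hX]
    refine Finset.sum_congr rfl fun Y hY => ?_
    rw [Finset.mem_powerset] at hY
    have hYA : Y ⊆ A.1 := hY.trans (hfree X)
    have hb : A.2.2 ∪ ((A.2.1 \ A.2.2) \ X) ⊆ D :=
      Finset.union_subset h22 (Finset.sdiff_subset.trans (Finset.sdiff_subset.trans h21))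
    have hS₂ : mkS₂ A X Y ⊆ A.1 :=
      Finset.union_subset (Finset.union_subset h31 (Finset.sdiff_subset.trans (Finset.sdiff_subset.trans hn.2))) hYA
    rw [hterm _ hS₁ _ hS₂, toMask_union idx hinj (hXA.trans hA) h22]
    unfold mkS₂
    rw [toMask_union idx hinj hb (hYA.trans hA), toMask_union idx hinj h22 (Finset.sdiff_subset.trans (Finset.sdiff_subset.trans h21))]
  -- Step 2: the multiset form
  rw [step1]
  unfold FibM
  simp only [hsub, Multiset.map_map, Function.comp_def, Finset.sum_eq_multiset_sum]
  refine congrArg Multiset.sum (Multiset.map_congr rfl fun X hX => ?_)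
  have hXs : X ⊆ A.1 \ A.2.2 := Finset.mem_powerset.mp (Finset.mem_val.mp hX)
  have hXD : X ⊆ D := hXs.trans (Finset.sdiff_subset.trans hA)
  have hP₁ : A.1 \ A.2.1 ⊆ D := Finset.sdiff_subset.trans hA
  have hP₂ : A.2.1 \ A.2.2 ⊆ D := Finset.sdiff_subset.trans h21
  have hfm : toMask idx (freeY A X) = bdiff (toMask idx (A.1 \ A.2.1)) (toMask idx X) ||| (toMask idx (A.2.1 \ A.2.2) &&& toMask idx X) := by
    unfold freeY
    rw [bdiff_eq, toMask_union idx hinj (Finset.sdiff_subset.trans hP₁) (Finset.inter_subset_left.trans hP₂),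
      toMask_sdiff idx hinj hP₁ hXD, toMask_inter idx hinj hP₂ hXD]
  rw [bdiff_eq (toMask idx (A.2.1 \ A.2.2)), ← toMask_sdiff idx hinj hP₂ hXD, ← hfm,
    ← map_toMask_powerset idx hinj ((hfree X).trans hA), Multiset.map_map, Function.comp_def]

/-- **Fibre criterion, bitmask form** (what a `native_decide` certificate discharges): an edge numbering injective on `D`,
a table `pol` of `PolZH`, a table `sub` of `submasks`, a cell table `st` on masks that is correct on `D.powerset`, and nonnegativity of the bitmask fibre sums
over all nested profiles imply `H_{q+t} ≥ 0` for all weights in `[0,1]`. [folklore] -/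
theorem hqtW_nonneg_of_fibM [Fintype V] (D : Finset (Sym2 V)) (K : Finset (Sym2 V)) (a b c : V) (idx : Sym2 V → ℕ)
    (pol : Fin 5 → Fin 5 → Fin 5 → ℤ) (st : ℕ → Fin 5) (sub : ℕ → Multiset ℕ) (p : Sym2 V → ℝ) (hp0 : ∀ e, 0 ≤ p e)
    (hp1 : ∀ e, p e ≤ 1) (hinj : Set.InjOn idx ↑D) (hpol : ∀ s₁ s₂ s₃, pol s₁ s₂ s₃ = PolZH s₁ s₂ s₃) (hsub : ∀ f, sub f = submasks f)
    (hst : ∀ S ∈ D.powerset, cellOK K a b c S (st (toMask idx S)) = true)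
    (hcheck : ∀ A₁ ∈ D.powerset, ∀ A₂ ∈ A₁.powerset, ∀ A₃ ∈ A₂.powerset, 0 ≤ FibM idx pol st sub (A₁, A₂, A₃)) :
    0 ≤ hqtW D p K a b c := by
  refine hqtW_nonneg_of_fibFastH D K a b c (fun S => st (toMask idx S)) p hp0 hp1 hst fun A₁ hA₁ A₂ hA₂ A₃ hA₃ => ?_
  rw [FibFastH_eq_FibM idx pol st sub hinj hpol hsub (A := (A₁, A₂, A₃)) (Finset.mem_powerset.mp hA₁)
    ⟨Finset.mem_powerset.mp hA₃, Finset.mem_powerset.mp hA₂⟩]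
  exact hcheck A₁ hA₁ A₂ hA₂ A₃ hA₃

end EnumH

end TerminalGluing

end Summit.CriticalPhenomena.PercolationContinuityZ3.Theorems
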